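import Mathlib
import Literature.Computability.AlgebraicComplexity.BurgisserBooleanPartsA3Assembly
import Literature.Computability.AlgebraicComplexity.RealTauConjectureDepthFour
import HarnessLib

/-!
# Route NumTame — Boolean simulation of circuits over `ZMod p` (support for
# stmt-ValiantsHypothesis-5391 `LowDegreeRegime`, finite-place twin)

`Literature…cktSize_testBits_aeval_eval` (Bürgisser 2000 TCS, §5 (A3)) simulates an INTEGER
circuit whose inputs are residues modulo `p` by `B₂`-circuits. Circuits that arise by reduction
modulo `p` (the finite-place route of `NumTame`) have their constants and sum weights in `ZMod p`
itself; this file supplies the lift and the packaged statement: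

* `liftInt Q` / `map_liftInt` — a circuit over `ZMod p` is the reduction of the integer circuit
  obtained by lifting every constant and weight along `ZMod.val` (same gates, same fan-in);
* `cktSize_testBits_of_zmod` — **a fan-in-two circuit `Q` over `ZMod p` (`p ≤ 2^ℓ`) yields
  `B₂`-circuits of size `(|Q| + 1) · gateCost ℓ ℓ` for the `ℓ` bits of its values at Boolean
  points** (`(eval (boolPoint x) Q.eval).val`).

Honest framing: plumbing for a conditional route; `VP ≠ VNP` is NOT proved and nothing here is
progress on it.

## References

* P. Bürgisser, *Cook's versus Valiant's hypothesis*, Theoret. Comput. Sci. 235 (2000), §5 (A3)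
  p. 86 (Boolean simulation of arithmetic modulo `p`). [cite: Burgisser2000TCS, §5 (A3) p. 86]
-/

set_option linter.dupNamespace false

noncomputable section

open MvPolynomial

namespace Summit.ValiantsHypothesis.ValiantsHypothesis.Theorems.NumTame

open Literature.Computability.AlgebraicComplexity Literature.Computability.Complexity ArithCircuit

variable {p : ℕ} {σ : Type*}

/-! ### Lifting a `ZMod p` circuit to an integer circuit -/

/-- Composition of two changes of coefficients on an operand. [folklore] -/
theorem Operand.map_map {k k' k'' : Type*} (ψ : k → k') (φ : k' → k'') (u : Operand k σ) :
    (u.map ψ).map φ = u.map (φ ∘ ψ) := by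
  cases u <;> rfl

/-- Composition of two changes of coefficients on a gate. [folklore] -/
theorem Gate.map_map {k k' k'' : Type*} (ψ : k → k') (φ : k' → k'') (g : Gate k σ) :
    (g.map ψ).map φ = g.map (φ ∘ ψ) := by
  cases g with
  | sum args =>
    simp only [Gate.map, List.map_map, Gate.sum.injEq]
    exact List.map_congr_left fun a _ => by simp [Operand.map_map]
  | prod args =>
    simp only [Gate.map, List.map_map, Gate.prod.injEq]
    exact List.map_congr_left fun u _ => Operand.map_map ψ φ u

/-- The identity change of coefficients on an operand. [folklore] -/
theorem Operand.map_id' {k : Type*} (u : Operand k σ) : u.map (fun c : k => c) = u := by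
  cases u <;> rfl

/-- The identity change of coefficients on a gate. [folklore] -/
theorem Gate.map_id' {k : Type*} (g : Gate k σ) : g.map (fun c : k => c) = g := by
  cases g with
  | sum args =>
    simp only [Gate.map, Gate.sum.injEq]
    conv_rhs => rw [← List.map_id args]
    exact List.map_congr_left fun a _ => by simp [Operand.map_id']
  | prod args =>
    simp only [Gate.map, Gate.prod.injEq]
    conv_rhs => rw [← List.map_id args]
    exact List.map_congr_left fun u _ => Operand.map_id' u

/-- **Integer lift of a circuit over `ZMod p`**: lift every constant and sum weight along
`ZMod.val : ZMod p → ℕ ⊆ ℤ` (plumbing def). [folklore] -/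
def liftInt [NeZero p] (Q : ArithCircuit (ZMod p) σ) : ArithCircuit ℤ σ where
  gates := Q.gates.map (Gate.map fun c : ZMod p => ((c.val : ℕ) : ℤ))
  output := Q.output.map fun c : ZMod p => ((c.val : ℕ) : ℤ)

/-- The lift has the same size. [folklore] -/
@[simp] theorem size_liftInt [NeZero p] (Q : ArithCircuit (ZMod p) σ) : (liftInt Q).size = Q.size := by
  simp [liftInt, ArithCircuit.size]

/-- The lift keeps fan-in two. [folklore] -/
theorem IsFanInTwo.liftInt [NeZero p] {Q : ArithCircuit (ZMod p) σ} (h : Q.IsFanInTwo) :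
    (liftInt Q).IsFanInTwo := by
  intro g hg
  obtain ⟨g', hg', rfl⟩ := List.mem_map.mp hg
  rw [Gate.fanIn_map]
  exact h g' hg'

/-- **Reducing the lift modulo `p` returns the circuit.** [folklore] -/
theorem map_liftInt [NeZero p] (Q : ArithCircuit (ZMod p) σ) :
    (liftInt Q).map (Int.castRingHom (ZMod p)) = Q := by
  have hid : ((Int.castRingHom (ZMod p) : ℤ → ZMod p) ∘ fun c : ZMod p => ((c.val : ℕ) : ℤ)) =
      fun c => c := by
    funext c
    simp
  cases Q with
  | mk gates output =>
    simp only [liftInt, ArithCircuit.map, List.map_map, ArithCircuit.mk.injEq]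
    refine ⟨?_, ?_⟩
    · conv_rhs => rw [← List.map_id gates]
      refine List.map_congr_left fun g _ => ?_
      rw [Function.comp_apply, Gate.map_map, hid, Gate.map_id', id]
    · rw [Operand.map_map, hid, Operand.map_id']

/-- The values of a `ZMod p` circuit at Boolean points are the values of its integer lift.
[folklore] -/
theorem eval_boolPoint_eq_aeval_liftInt [NeZero p] (Q : ArithCircuit (ZMod p) σ) (x : σ → Bool) :
    eval (boolPoint (ZMod p) x) Q.eval = aeval (boolPoint (ZMod p) x) (liftInt Q).eval := by
  conv_lhs => rw [← map_liftInt Q, ArithCircuit.eval_map_apply]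
  rw [MvPolynomial.eval_map, aeval_def, algebraMap_int_eq]

/-! ### The Boolean simulation -/

/-- **Boolean simulation of a circuit over `ZMod p`**: for a prime `p ≤ 2^ℓ` and a fan-in-two
circuit `Q` over `ZMod p` in `n` variables, the `ℓ` bits of the values of `Q` at Boolean points
have `B₂`-circuits of size `(|Q| + 1) · gateCost ℓ ℓ` (lift to `ℤ`, `liftInt`, and simulate with
`cktSize_testBits_aeval_eval`; the input residues `[x_i] ∈ {0,1}` cost `ℓ` gates each,
`cktSize_testBits_inputResidue`). [cite: Burgisser2000TCS, §5 (A3) p. 86] -/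
theorem cktSize_testBits_of_zmod [Fact p.Prime] {n ℓ : ℕ} (hℓ : p ≤ 2 ^ ℓ)
    (Q : ArithCircuit (ZMod p) (Fin n)) (hQ : Q.IsFanInTwo) :
    CktSize B2 (fun x : Fin n → Bool => testBits ℓ (eval (boolPoint (ZMod p) x) Q.eval).val)
      ((Q.size + 1) * gateCost ℓ (ℓ * 1)) := by
  haveI : Fact (1 < p) := ⟨(Fact.out : p.Prime).one_lt⟩
  have hz : ∀ v : Fin n, CktSize B2
      (fun x : Fin n → Bool => testBits ℓ (boolPoint (ZMod p) x v).val) (ℓ * 1) := fun v =>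
    (cktSize_testBits_inputResidue (p := p) ℓ n v).congr fun x b => by simp [boolPoint_apply]
  have h := cktSize_testBits_aeval_eval hℓ (fun x : Fin n → Bool => boolPoint (ZMod p) x) hz
    (liftInt Q) (IsFanInTwo.liftInt hQ)
  rw [size_liftInt] at h
  exact h.congr fun x b => by rw [eval_boolPoint_eq_aeval_liftInt]

end Summit.ValiantsHypothesis.ValiantsHypothesis.Theorems.NumTame

end
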